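import Summits.CriticalPhenomena.SAWScalingLimit.Theorems.SAWDefectDecoherenceObservableToSLERTwoPieceAdmIdentificationMesh
import HarnessLib

/-!
# Pinned lattice walks as plane paths: a walk whose pinned vertices keep distance `> s` from a
# set `C` joins its endpoints off `C` (piece (T-A′ link-b) of stub T-A′
# `stub_carvedReduction_squeezeGeometry_domains`)

Crux `SAWDevelopingMap.ObservableToSLE` (stmt-CriticalPhenomena-10472), line `six-class-type-ladder`,
stub T-A′ `stub_carvedReduction_squeezeGeometry_domains`.  Landing target:
`Summits/CriticalPhenomena/SAWScalingLimit/Theorems/SAWDevelopingMapObservableToSLETypeLadderCarvedReductionSqueezeLinkPolyline.lean`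
(`--supports stmt-CriticalPhenomena-10472`; registered carrier `stub_carvedReduction_linkPolyline`).

The continuum half of the bulk LINK of the framed super-domain (hypothesis `JoinedIn …` of
`stub_carvedReduction_superFrame`; lattice half: `…SqueezeMiddleWalk`) and of the reach clause (R)
(every vertex of a removed-set-avoiding walk from the gate is joined to the bulk off the cuts):
the pinned polyline of a walk of `Ω_s` at mesh `s` has edges of length `≤ s`
(`TwoPiece.dist_smul_hexCenter_le_of_adj`), so if every pinned vertex
`s c_v - s · triEmbed y` is at distance `> s` from a set `C`, consecutive pinned vertices are
joined by segments off `C` and the endpoints are `JoinedIn Cᶜ` (`joinedIn_of_walk`,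
`stub_carvedReduction_linkPolyline`).
-/

noncomputable section

open Set Metric
open Literature.Probability.LatticeModels (HexVertex hexGraph hexCenter triEmbed Site)
open Literature.Probability.RandomPlanarGeometry
open Literature.Probability.RandomPlanarGeometry.SAW

namespace Summit.CriticalPhenomena.SAWScalingLimit.Theorems.ObservableToSLE.TypeLadder

open Summit.CriticalPhenomena.SAWScalingLimit.Theorems.ObservableToSLER.TwoPiece (dist_smul_hexCenter_le_of_adj)

/-- **A walk whose edges map to segments inside `A` joins its endpoints in `A`.** -/
theorem joinedIn_of_walk {V : Type*} {G : SimpleGraph V} (f : V → ℂ) {A : Set ℂ} {a b : V} (w : G.Walk a b)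
    (h : ∀ u v : V, G.Adj u v → u ∈ w.support → v ∈ w.support → segment ℝ (f u) (f v) ⊆ A)
    (ha : f a ∈ A) : JoinedIn A (f a) (f b) := by
  induction w with
  | nil => exact JoinedIn.refl ha
  | @cons u v b hadj p ih =>
    have hseg : segment ℝ (f u) (f v) ⊆ A :=
      h u v hadj (SimpleGraph.Walk.start_mem_support _) (by simp)
    have hv : f v ∈ A := hseg (right_mem_segment ℝ (f u) (f v))
    refine (JoinedIn.of_segment_subset hseg).trans (ih (fun x y hxy hx hy => h x y hxy ?_ ?_) hv)
    · simp [hx]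
    · simp [hy]

/-- **Registered carrier `stub_carvedReduction_linkPolyline`** (crux item stmt-CriticalPhenomena-10472,
stub T-A′ `stub_carvedReduction_squeezeGeometry_domains`, piece PINNED WALKS OFF A SET): a walk of
the domain graph `Ω_s` (mesh `s ≥ 0`) all of whose pinned vertices `s c_v - s · triEmbed y` are at
distance `> s` from `C` has all the segments between consecutive pinned vertices off `C`; in
particular its pinned endpoints are joined in `Cᶜ`. -/
theorem stub_carvedReduction_linkPolyline :
    ∀ (Ω : Set ℂ) (s : ℝ) (y : Site 2) (C : Set ℂ) (a b : HexVertex) (w : (hexDomainGraph Ω s).Walk a b),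
      0 ≤ s → (∀ v ∈ w.support, s < infDist ((s : ℂ) * hexCenter v - (s : ℂ) * triEmbed y) C) →
      (∀ u ∈ w.support, ∀ v ∈ w.support, hexGraph.Adj u v →
        segment ℝ ((s : ℂ) * hexCenter u - (s : ℂ) * triEmbed y) ((s : ℂ) * hexCenter v - (s : ℂ) * triEmbed y) ⊆ Cᶜ) ∧
      JoinedIn Cᶜ ((s : ℂ) * hexCenter a - (s : ℂ) * triEmbed y) ((s : ℂ) * hexCenter b - (s : ℂ) * triEmbed y) := by
  intro Ω s y C a b w hs hfar
  have hseg : ∀ u ∈ w.support, ∀ v ∈ w.support, hexGraph.Adj u v →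
      segment ℝ ((s : ℂ) * hexCenter u - (s : ℂ) * triEmbed y) ((s : ℂ) * hexCenter v - (s : ℂ) * triEmbed y) ⊆ Cᶜ := by
    intro u hu v hv huv z hz hzC
    have hd : dist ((s : ℂ) * hexCenter u - (s : ℂ) * triEmbed y) ((s : ℂ) * hexCenter v - (s : ℂ) * triEmbed y) ≤ s := by
      rw [dist_eq_norm, show (s : ℂ) * hexCenter u - (s : ℂ) * triEmbed y - ((s : ℂ) * hexCenter v - (s : ℂ) * triEmbed y) =
        (s : ℂ) * hexCenter u - (s : ℂ) * hexCenter v by ring, ← dist_eq_norm]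
      exact dist_smul_hexCenter_le_of_adj hs huv
    have hzu : dist ((s : ℂ) * hexCenter u - (s : ℂ) * triEmbed y) z ≤ s := by
      have h1 : z ∈ closedBall ((s : ℂ) * hexCenter u - (s : ℂ) * triEmbed y) s :=
        (convex_closedBall _ _).segment_subset (mem_closedBall_self hs) (mem_closedBall.2 (by rwa [dist_comm])) hz
      rw [dist_comm]; exact mem_closedBall.1 h1
    have := (infDist_le_dist_of_mem hzC).trans hzu
    linarith [hfar u hu]
  refine ⟨hseg, joinedIn_of_walk (fun v : HexVertex => (s : ℂ) * hexCenter v - (s : ℂ) * triEmbed y) w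
    (fun u v huv hu hv => hseg u hu v hv (embDomainGraph_le hexGraph hexCenter Ω s huv)) ?_⟩
  intro haC
  have := (infDist_zero_of_mem haC).symm
  linarith [hfar a (SimpleGraph.Walk.start_mem_support _), this.le]

end Summit.CriticalPhenomena.SAWScalingLimit.Theorems.ObservableToSLE.TypeLadder

end
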